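import Summits.BirchSwinnertonDyer.Rank1Residual.Supersingular.KuriharaTwistRecordAssembly
import Summits.BirchSwinnertonDyer.Rank1Residual.Supersingular.KuriharaTwistRoundingHasseCheck
import HarnessLib

/-!
# Twist records ASSEMBLED WITH THEIR ROUNDING CERTIFICATES: `certL` row + `certR` row (Hasse check) +
# the engine's ENCLOSURE claim + class binders ⟹ `BSD(E,p)` on X6 / X7 — the exact-bins hypothesis
# `hbins` of `KuriharaTwistRecordAssembly` replaced by a BALL hypothesis, the rounding done by the kernel

Cell `b2b-bsdres`, supersingular family, prover A = unit `b2b-bsdres-x10b` (gen 11).  Topic file; namespace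
`Summit.BirchSwinnertonDyer.Rank1Residual.Supersingular`.  THEOREMS ONLY (compositions by name); no named
fact, no definition, nothing asserted about any curve, nothing booked; X6 / X7 stay CONSTRUCTION-SHAPED.

HONEST FRAMING (run/shared/lean/b2b/bsd-rank1-residual/, verbatim): the goal of the cell is to DELETE the
COMBINATION-SHAPED residual classes of the BSD formula in analytic rank `≤ 1` from PUBLISHED theorems only
and to TYPE the construction-shaped ones; this is not "finishing BSD".

## What this file does (X6-KURIHARA.md §10–§11)

Gen 10 reduced the chain "landed twist record ⟹ `kuriharaNumber f p n ψ ≠ 0` ⟹ `BSD(E,p)`" to tree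
theorems modulo ONE hypothesis, `hbins`: the recorded integers ARE the exact bins,
`bins[j] = D · c_∞ · Σ_{a : m(a) = j} [a/n]⁺_f` (`X6/X7.bsdp_rank{Zero,One}_of_certifiedL`).  Separately
every landed level carries a ROUNDING CERTIFICATE (`certR_…`, schema `KuriharaTwistRoundingSchema`;
3 775 rows, and the implementation-3d rows of gen 11), and gen 10 proved the soundness of certified
rounding in `f`-units as a THEOREM (`KuriharaTwistRoundingIntegrality.sum_ratPlusSymbol_eq_div_of_ball`,
row form `RoundingCert.sum_ratPlusSymbol_eq_div_of_validHasse`: newform `f` of `E`, good `p`,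
`gcd(n, N) = 1`, a ball `mid ± rad ∋ D'·x` with `rad`, `|mid − J|` inside the recorded bounds and
`8p(mar + rad) < 1` ⟹ `x = J/D'` EXACTLY — no Manin constant, no torsion, no optimality).

This file COMPOSES the two: `TwistRecord.bins_eq_of_validHasse_of_ball` derives `hbins` for a twist
record `r` from (i) a rounding certificate `c` passing `validHasse` whose key fields match `r`'s
(`c.p = r.p`, `c.n = r.n`, `c.den = r.den`, `c.bins = r.bins`, `0 < c.dstar` — decidable per row), and
(ii) the engine's ENCLOSURE claim `hball`: for each `j < p` the engine's ball (some centre `mid` within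
`marNum/10^marExp` of the recorded integer `binsStar[j]`, some radius `rad ≤ radNum/10^radExp`) CONTAINS
`D' · c_∞ · Σ_{m(a) = j} [a/n]⁺_f`.  Then `X6/X7.bsdp_rank{Zero,One}_of_certifiedL_of_roundingCert`: the
four assembled consumers with `hbins` replaced by `(hcs : RoundingCertifiedHasse cs) (hc : c ∈ cs)` + the
matching equalities + `hball` (+ `Nat.Coprime r.n N`, the level of `f`).  WHAT REMAINS OUTSIDE THE KERNEL is
thereby weakened from "the recorded bins are exactly right" to "the recorded ball contains the true
value" — i.e. exactly what implementation 3c/3d computes (Arb ball arithmetic with a rigorous tail, on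
Birch's formula, with the period identification `Ω⁺_f = c_∞·ω₁`); the rounding inference itself is now a
kernel step.  Per pair; NOT a class theorem; nothing booked (lane + referee book pairs).

References: `KuriharaTwistRecordAssembly.lean`, `KuriharaTwistRoundingIntegrality.lean`,
`KuriharaTwistRoundingHasseCheck.lean` (this lineage, gens 9–10); C.-H. Kim, Amer. J. Math. 148 (2026)
Thm. 1.8 (6) [Kim2022StructureSelmer]; J. E. Cremona, *Algorithms for Modular Elliptic Curves* (1997) §2.8
[CremonaAlgorithms1997].
-/

noncomputable section

open scoped Classical MatrixGroups ModularForm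

open CongruenceSubgroup WeierstrassCurve Literature.NumberTheory.EllipticCurves
  Literature.NumberTheory.EllipticCurves.ModularForms
  Literature.NumberTheory.EllipticCurves.Rank1Residual
  Literature.NumberTheory.EllipticCurves.Rank1Residual.Typed
  Summit.BirchSwinnertonDyer.Rank1Residual.Supersingular.KuriharaTwist

namespace Summit.BirchSwinnertonDyer.Rank1Residual.Supersingular

namespace KuriharaTwist

/-- For `j` below both lengths, the pair of `j`-th defaults lies in the zipped list. [folklore] -/
theorem getD_mem_zip {α β : Type*} (l₁ : List α) (l₂ : List β) (d₁ : α) (d₂ : β) {j : ℕ}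
    (h₁ : j < l₁.length) (h₂ : j < l₂.length) : (l₁.getD j d₁, l₂.getD j d₂) ∈ l₁.zip l₂ := by
  have hj : j < (l₁.zip l₂).length := by rw [List.length_zip]; exact lt_min h₁ h₂
  have h := List.getElem_mem hj
  rw [List.getElem_zip] at h
  rwa [List.getD_eq_getElem l₁ d₁ h₁, List.getD_eq_getElem l₂ d₂ h₂]

/-- The two list-length conjuncts of a `validHasse` certificate. [folklore] -/
theorem RoundingCert.lengths_of_validHasse {c : RoundingCert} (h : c.validHasse = true) :
    c.bins.length = c.p ∧ c.binsStar.length = c.p := by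
  simp only [RoundingCert.validHasse, Bool.and_eq_true, decide_eq_true_eq, beq_iff_eq] at h
  exact ⟨h.1.1.1.1.1, h.1.1.1.1.2⟩

variable {N : ℕ} [NeZero N] {f : CuspForm (Gamma0 N) 2}
  {W : WeierstrassCurve ℚ} [W.IsElliptic] [W.IsGloballyMinimal]

/-- **`hbins` FROM A ROUNDING CERTIFICATE + THE ENGINE'S ENCLOSURE.**  `r` a twist record, `c` a rounding
certificate passing `validHasse` with `c.p = r.p`, `c.n = r.n`, `c.den = r.den`, `c.bins = r.bins`,
`0 < c.dstar`; `f` the newform of `E = W`, good reduction at `r.p`, `gcd(r.n, N) = 1`; bins indexed by the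
discrete logarithms `ψ`.  IF for every `j < p` the engine's ball — centre `mid` within `marNum/10^marExp` of
`binsStar[j]`, radius `rad ≤ radNum/10^radExp` — contains `D' · c_∞ · Σ_{m(a)=j} [a/n]⁺_f` (`hball`), THEN
`bins[j] = D · c_∞ · Σ_{m(a)=j} [a/n]⁺_f` exactly (the `hbins` of `X6/X7.bsdp_rank{Zero,One}_of_certifiedL`):
soundness `RoundingCert.sum_ratPlusSymbol_eq_div_of_validHasse` gives `c_∞·Σ = J/D'`, and the certificate's
rescaling identity `J·D = bins[j]·D'` finishes. [cite: CremonaAlgorithms1997, §2.8 (2.8.8) (PDF p. 26)] -/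
theorem TwistRecord.bins_eq_of_validHasse_of_ball (r : TwistRecord) {c : RoundingCert}
    (hc : c.validHasse = true) [Fact r.p.Prime] [NeZero r.n]
    (hcp : c.p = r.p) (hcn : c.n = r.n) (hcden : c.den = r.den) (hcbins : c.bins = r.bins)
    (hD' : 0 < c.dstar) (hf : IsNewformOf W f) (hgood : W.HasGoodReductionAtPrime r.p)
    (hcop : Nat.Coprime r.n N) (ψ : (ℓ : ℕ) → (ZMod ℓ)ˣ →* Multiplicative (ZMod (r.p ^ 1)))
    (hball : ∀ j < r.p, ∃ mid rad : ℝ, rad ≤ (c.radNum : ℝ) / 10 ^ c.radExp ∧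
      |mid - ((c.binsStar.getD j 0 : ℤ) : ℝ)| ≤ (c.marNum : ℝ) / 10 ^ c.marExp ∧
      |(c.dstar : ℝ) * (((r.components : ℚ) *
        ∑ a ∈ (Finset.univ : Finset (ZMod r.n)ˣ).filter (fun a =>
          (∑ ℓ ∈ r.n.primeFactors.attach, Multiplicative.toAdd
            (ψ ℓ.1 (ZMod.unitsMap (Nat.dvd_of_mem_primeFactors ℓ.2) a))).val = j),
          ratPlusSymbol f ((((a : ZMod r.n).val : ℕ) : ℚ) / (r.n : ℚ)) : ℚ) : ℝ) - mid| ≤ rad) :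
    ∀ j < r.p, ((r.bins.getD j 0 : ℤ) : ℚ) = (r.den : ℚ) * (r.components : ℚ) *
      ∑ a ∈ (Finset.univ : Finset (ZMod r.n)ˣ).filter (fun a =>
        (∑ ℓ ∈ r.n.primeFactors.attach, Multiplicative.toAdd
          (ψ ℓ.1 (ZMod.unitsMap (Nat.dvd_of_mem_primeFactors ℓ.2) a))).val = j),
        ratPlusSymbol f ((((a : ZMod r.n).val : ℕ) : ℚ) / (r.n : ℚ)) := by
  intro j hj
  haveI : Fact c.p.Prime := ⟨hcp ▸ (Fact.out : r.p.Prime)⟩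
  set S : Finset (ZMod r.n)ˣ := (Finset.univ : Finset (ZMod r.n)ˣ).filter (fun a =>
      (∑ ℓ ∈ r.n.primeFactors.attach, Multiplicative.toAdd
        (ψ ℓ.1 (ZMod.unitsMap (Nat.dvd_of_mem_primeFactors ℓ.2) a))).val = j) with hS
  obtain ⟨mid, rad, hrad, hmar, hb⟩ := hball j hj
  -- the weighted sum of the soundness theorem, with constant weight `c_∞` and arguments `a.val`
  have hsum : ∑ a ∈ S, (((r.components : ℤ)) : ℚ) * ratPlusSymbol f (((((a : ZMod r.n).val : ℤ)) : ℚ) / (r.n : ℚ))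
      = (r.components : ℚ) * ∑ a ∈ S, ratPlusSymbol f ((((a : ZMod r.n).val : ℕ) : ℚ) / (r.n : ℚ)) := by
    rw [Finset.mul_sum]
    refine Finset.sum_congr rfl fun a _ => ?_
    push_cast; ring
  have hgood' : W.HasGoodReductionAtPrime c.p := by
    have key : ∀ (q : ℕ) [Fact q.Prime], q = r.p → W.HasGoodReductionAtPrime q := by
      intro q _ hq; subst hq; exact hgood
    exact key c.p hcp
  have hcop' : Nat.Coprime c.n N := by rw [hcn]; exact hcop
  have hball' : |(c.dstar : ℝ) * ((∑ a ∈ S, (((r.components : ℤ)) : ℚ) *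
      ratPlusSymbol f (((((a : ZMod r.n).val : ℤ)) : ℚ) / (c.n : ℚ)) : ℚ) : ℝ) - mid| ≤ rad := by
    rw [hcn, hsum]; exact hb
  have hx := RoundingCert.sum_ratPlusSymbol_eq_div_of_validHasse hc hf hgood' hcop' S
    (fun _ => (r.components : ℤ)) (fun a => ((a : ZMod r.n).val : ℤ)) hD' hball' hrad hmar
  rw [hcn, hsum] at hx
  -- rescaling identity `J · D = bins[j] · D'` of the certificate
  obtain ⟨hlb, hls⟩ := RoundingCert.lengths_of_validHasse hc
  have hmem : (c.bins.getD j 0, c.binsStar.getD j 0) ∈ c.bins.zip c.binsStar :=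
    getD_mem_zip c.bins c.binsStar 0 0 (by rw [hlb, hcp]; exact hj) (by rw [hls, hcp]; exact hj)
  have hresc := RoundingCert.rescale_of_validHasse hc _ hmem
  simp only at hresc
  rw [hcbins, hcden] at hresc
  -- `bins[j] = den · (c_∞ Σ) = den · J / D'`
  have hD'q : (c.dstar : ℚ) ≠ 0 := by exact_mod_cast hD'.ne'
  rw [mul_assoc, hx]
  field_simp
  exact_mod_cast hresc.symm.trans (mul_comm _ _)

end KuriharaTwist

variable (W : WeierstrassCurve ℚ) [W.IsElliptic] [W.IsGloballyMinimal]

/-- **X6 ∧ `r_an = 0` ∧ `p ≥ 5` ∧ `p ∤ ∏c`: `BSD(E,p)` from a LANDED twist record AND ITS ROUNDING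
CERTIFICATE** — `X6.bsdp_rankZero_of_certifiedL` with the exact-bins hypothesis `hbins` REPLACED by: a row `c`
of a `RoundingCertifiedHasse` list matching `r` (`p, n, den, bins`; `0 < D'`), `gcd(r.n, N) = 1`, and the
engine's ENCLOSURE claim `hball` (the Arb ball contains `D'·c_∞·Σ_{m(a)=j}[a/n]⁺_f`); the rounding to exact
bins is done by the kernel (`TwistRecord.bins_eq_of_validHasse_of_ball`).  Per pair; NOT a class theorem;
nothing booked. [cite: Kim2022StructureSelmer, Thm. 1.9 (6) (PDF p. 8), Cor. 1.6]
[cite: CremonaAlgorithms1997, §2.8 (2.8.8) (PDF p. 26)] -/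
theorem X6.bsdp_rankZero_of_certifiedL_of_roundingCert
    (hKim : Kim2022_rankZero_padicValRat_sha_of_kuriharaNumber_ne_zero)
    (hϖ : realPeriodRat_eq_unit_mul_plusPeriod)
    (hGZK : rank_eq_analyticRank_of_analyticRank_le_one) (hmod : hasEntireLFunction_rat)
    {rs : List TwistRecord} (hrs : CertifiedL rs) {r : TwistRecord} (hr : r ∈ rs) [Fact r.p.Prime]
    (hνp : r.primes.length < r.p) [NeZero r.n] (hν : r.n.primeFactors.card = r.primes.length)
    {cs : List RoundingCert} (hcs : RoundingCertifiedHasse cs) {c : RoundingCert} (hc : c ∈ cs)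
    (hcp : c.p = r.p) (hcn : c.n = r.n) (hcden : c.den = r.den) (hcbins : c.bins = r.bins)
    (hD' : 0 < c.dstar)
    (hp : 5 ≤ r.p) (hX : ClassX6 W r.p) (hr0 : W.analyticRank = 0) (htam : ¬ r.p ∣ W.tamagawaProduct)
    {N : ℕ} [NeZero N] (f : CuspForm (Gamma0 N) 2) (hf : IsNewformOf W f) (hcop : Nat.Coprime r.n N)
    (hn : Kato.IsKolyvaginProduct W r.p 1 r.n)
    (hcyc : ∀ (ℓ : ℕ) [Fact ℓ.Prime], ℓ ∣ r.n →
      Nat.card {P : ((WeierstrassCurve.integralModelInt W).map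
          (Int.castRingHom (ZMod ℓ))).toAffine.Point // r.p • P = 0} ≤ r.p)
    (ψ : (ℓ : ℕ) → (ZMod ℓ)ˣ →* Multiplicative (ZMod (r.p ^ 1)))
    (hψ : ∀ ℓ ∈ r.n.primeFactors, Function.Surjective (ψ ℓ))
    (hball : ∀ j < r.p, ∃ mid rad : ℝ, rad ≤ (c.radNum : ℝ) / 10 ^ c.radExp ∧
      |mid - ((c.binsStar.getD j 0 : ℤ) : ℝ)| ≤ (c.marNum : ℝ) / 10 ^ c.marExp ∧
      |(c.dstar : ℝ) * (((r.components : ℚ) *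
        ∑ a ∈ (Finset.univ : Finset (ZMod r.n)ˣ).filter (fun a =>
          (∑ ℓ ∈ r.n.primeFactors.attach, Multiplicative.toAdd
            (ψ ℓ.1 (ZMod.unitsMap (Nat.dvd_of_mem_primeFactors ℓ.2) a))).val = j),
          ratPlusSymbol f ((((a : ZMod r.n).val : ℕ) : ℚ) / (r.n : ℚ)) : ℚ) : ℝ) - mid| ≤ rad) :
    BSDp W r.p :=
  X6.bsdp_rankZero_of_certifiedL W hKim hϖ hGZK hmod hrs hr hνp hν hp hX hr0 htam f hf hn hcyc ψ hψ
    (r.bins_eq_of_validHasse_of_ball (hcs.validHasse_of_mem hc) hcp hcn hcden hcbins hD' hf hX.1.1 hcop ψ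
      hball)

/-- **X7 ∧ `r_an = 0` ∧ `p ≥ 5` ∧ surj(p) ∧ `p ∤ ∏c`: `BSD(E,p)` from a LANDED twist record and its
rounding certificate** (as `X6.bsdp_rankZero_of_certifiedL_of_roundingCert`, with the surjectivity binder).
Per pair; nothing booked. [cite: Kim2022StructureSelmer, Thm. 1.9 (6) (PDF p. 8), Cor. 1.6]
[cite: CremonaAlgorithms1997, §2.8 (2.8.8) (PDF p. 26)] -/
theorem X7.bsdp_rankZero_of_certifiedL_of_roundingCert
    (hKim : Kim2022_rankZero_padicValRat_sha_of_kuriharaNumber_ne_zero)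
    (hϖ : realPeriodRat_eq_unit_mul_plusPeriod)
    (hGZK : rank_eq_analyticRank_of_analyticRank_le_one) (hmod : hasEntireLFunction_rat)
    {rs : List TwistRecord} (hrs : CertifiedL rs) {r : TwistRecord} (hr : r ∈ rs) [Fact r.p.Prime]
    (hνp : r.primes.length < r.p) [NeZero r.n] (hν : r.n.primeFactors.card = r.primes.length)
    {cs : List RoundingCert} (hcs : RoundingCertifiedHasse cs) {c : RoundingCert} (hc : c ∈ cs)
    (hcp : c.p = r.p) (hcn : c.n = r.n) (hcden : c.den = r.den) (hcbins : c.bins = r.bins)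
    (hD' : 0 < c.dstar)
    (hp : 5 ≤ r.p) (hX : ClassX7 W r.p) (hsurj : Surj W r.p) (hr0 : W.analyticRank = 0)
    (htam : ¬ r.p ∣ W.tamagawaProduct)
    {N : ℕ} [NeZero N] (f : CuspForm (Gamma0 N) 2) (hf : IsNewformOf W f) (hcop : Nat.Coprime r.n N)
    (hn : Kato.IsKolyvaginProduct W r.p 1 r.n)
    (hcyc : ∀ (ℓ : ℕ) [Fact ℓ.Prime], ℓ ∣ r.n →
      Nat.card {P : ((WeierstrassCurve.integralModelInt W).map
          (Int.castRingHom (ZMod ℓ))).toAffine.Point // r.p • P = 0} ≤ r.p)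
    (ψ : (ℓ : ℕ) → (ZMod ℓ)ˣ →* Multiplicative (ZMod (r.p ^ 1)))
    (hψ : ∀ ℓ ∈ r.n.primeFactors, Function.Surjective (ψ ℓ))
    (hball : ∀ j < r.p, ∃ mid rad : ℝ, rad ≤ (c.radNum : ℝ) / 10 ^ c.radExp ∧
      |mid - ((c.binsStar.getD j 0 : ℤ) : ℝ)| ≤ (c.marNum : ℝ) / 10 ^ c.marExp ∧
      |(c.dstar : ℝ) * (((r.components : ℚ) *
        ∑ a ∈ (Finset.univ : Finset (ZMod r.n)ˣ).filter (fun a =>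
          (∑ ℓ ∈ r.n.primeFactors.attach, Multiplicative.toAdd
            (ψ ℓ.1 (ZMod.unitsMap (Nat.dvd_of_mem_primeFactors ℓ.2) a))).val = j),
          ratPlusSymbol f ((((a : ZMod r.n).val : ℕ) : ℚ) / (r.n : ℚ)) : ℚ) : ℝ) - mid| ≤ rad) :
    BSDp W r.p :=
  X7.bsdp_rankZero_of_certifiedL W hKim hϖ hGZK hmod hrs hr hνp hν hp hX hsurj hr0 htam f hf hn hcyc ψ hψ
    (r.bins_eq_of_validHasse_of_ball (hcs.validHasse_of_mem hc) hcp hcn hcden hcbins hD' hf hX.1.1 hcop ψ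
      hball)

/-- **X7 ∧ `r_an = 1` ∧ `p ≥ 5` ∧ surj(p), `ord_p #Ш_an = 0`: `BSD(E,p)` from a LANDED prime-level twist
record and its rounding certificate** (`X7.bsdp_rankOne_of_certifiedL` with `hbins` replaced by the
certificate + enclosure). Per pair; nothing booked. [cite: Kim2022StructureSelmer, Thm. 1.9 (6) (PDF p. 8), Cor. 1.6]
[cite: CremonaAlgorithms1997, §2.8 (2.8.8) (PDF p. 26)] -/
theorem X7.bsdp_rankOne_of_certifiedL_of_roundingCert
    (hKim : Kim2022_rankOne_card_sha_eq_one_of_kuriharaNumber_ne_zero)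
    (hϖ : realPeriodRat_eq_unit_mul_plusPeriod)
    (hGZK : rank_eq_analyticRank_of_analyticRank_le_one) (hmod : hasEntireLFunction_rat)
    {rs : List TwistRecord} (hrs : CertifiedL rs) {r : TwistRecord} (hr : r ∈ rs) [Fact r.p.Prime]
    [Fact r.n.Prime] (hνp : r.primes.length < r.p) (hν : r.n.primeFactors.card = r.primes.length)
    {cs : List RoundingCert} (hcs : RoundingCertifiedHasse cs) {c : RoundingCert} (hc : c ∈ cs)
    (hcp : c.p = r.p) (hcn : c.n = r.n) (hcden : c.den = r.den) (hcbins : c.bins = r.bins)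
    (hD' : 0 < c.dstar)
    (hp : 5 ≤ r.p) (hX : ClassX7 W r.p) (hsurj : Surj W r.p) (hr1 : W.analyticRank = 1)
    {q : ℚ} (hq : shaAn W = (q : ℂ)) (hv : padicValRat r.p q = 0)
    {N : ℕ} [NeZero N] (f : CuspForm (Gamma0 N) 2) (hf : IsNewformOf W f) (hcop : Nat.Coprime r.n N)
    (hℓ : Kato.IsKolyvaginPrime W r.p 1 r.n)
    (hcyc : Nat.card {P : ((WeierstrassCurve.integralModelInt W).map
        (Int.castRingHom (ZMod r.n))).toAffine.Point // r.p • P = 0} ≤ r.p)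
    (ψ : (ℓ' : ℕ) → (ZMod ℓ')ˣ →* Multiplicative (ZMod (r.p ^ 1)))
    (hψ : Function.Surjective (ψ r.n))
    (hball : ∀ j < r.p, ∃ mid rad : ℝ, rad ≤ (c.radNum : ℝ) / 10 ^ c.radExp ∧
      |mid - ((c.binsStar.getD j 0 : ℤ) : ℝ)| ≤ (c.marNum : ℝ) / 10 ^ c.marExp ∧
      |(c.dstar : ℝ) * (((r.components : ℚ) *
        ∑ a ∈ (Finset.univ : Finset (ZMod r.n)ˣ).filter (fun a =>
          (∑ ℓ ∈ r.n.primeFactors.attach, Multiplicative.toAdd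
            (ψ ℓ.1 (ZMod.unitsMap (Nat.dvd_of_mem_primeFactors ℓ.2) a))).val = j),
          ratPlusSymbol f ((((a : ZMod r.n).val : ℕ) : ℚ) / (r.n : ℚ)) : ℚ) : ℝ) - mid| ≤ rad) :
    BSDp W r.p :=
  haveI : NeZero r.n := ⟨(Fact.out : r.n.Prime).ne_zero⟩
  X7.bsdp_rankOne_of_certifiedL W hKim hϖ hGZK hmod hrs hr hνp hν hp hX hsurj hr1 hq hv f hf hℓ hcyc ψ hψ
    (r.bins_eq_of_validHasse_of_ball (hcs.validHasse_of_mem hc) hcp hcn hcden hcbins hD' hf hX.1.1 hcop ψ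
      hball)

/-- **X6 ∧ `r_an = 1` ∧ `p ≥ 5`, `ord_p #Ш_an = 0`: `BSD(E,p)` from a LANDED prime-level twist record and
its rounding certificate** (`X6.bsdp_rankOne_of_certifiedL` with `hbins` replaced by the certificate +
enclosure). Per pair; nothing booked. [cite: Kim2022StructureSelmer, Thm. 1.9 (6) (PDF p. 8), Cor. 1.6]
[cite: CremonaAlgorithms1997, §2.8 (2.8.8) (PDF p. 26)] -/
theorem X6.bsdp_rankOne_of_certifiedL_of_roundingCert
    (hKim : Kim2022_rankOne_card_sha_eq_one_of_kuriharaNumber_ne_zero)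
    (hϖ : realPeriodRat_eq_unit_mul_plusPeriod)
    (hGZK : rank_eq_analyticRank_of_analyticRank_le_one) (hmod : hasEntireLFunction_rat)
    {rs : List TwistRecord} (hrs : CertifiedL rs) {r : TwistRecord} (hr : r ∈ rs) [Fact r.p.Prime]
    [Fact r.n.Prime] (hνp : r.primes.length < r.p) (hν : r.n.primeFactors.card = r.primes.length)
    {cs : List RoundingCert} (hcs : RoundingCertifiedHasse cs) {c : RoundingCert} (hc : c ∈ cs)
    (hcp : c.p = r.p) (hcn : c.n = r.n) (hcden : c.den = r.den) (hcbins : c.bins = r.bins)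
    (hD' : 0 < c.dstar)
    (hp : 5 ≤ r.p) (hX : ClassX6 W r.p) (hr1 : W.analyticRank = 1)
    {q : ℚ} (hq : shaAn W = (q : ℂ)) (hv : padicValRat r.p q = 0)
    {N : ℕ} [NeZero N] (f : CuspForm (Gamma0 N) 2) (hf : IsNewformOf W f) (hcop : Nat.Coprime r.n N)
    (hℓ : Kato.IsKolyvaginPrime W r.p 1 r.n)
    (hcyc : Nat.card {P : ((WeierstrassCurve.integralModelInt W).map
        (Int.castRingHom (ZMod r.n))).toAffine.Point // r.p • P = 0} ≤ r.p)
    (ψ : (ℓ' : ℕ) → (ZMod ℓ')ˣ →* Multiplicative (ZMod (r.p ^ 1)))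
    (hψ : Function.Surjective (ψ r.n))
    (hball : ∀ j < r.p, ∃ mid rad : ℝ, rad ≤ (c.radNum : ℝ) / 10 ^ c.radExp ∧
      |mid - ((c.binsStar.getD j 0 : ℤ) : ℝ)| ≤ (c.marNum : ℝ) / 10 ^ c.marExp ∧
      |(c.dstar : ℝ) * (((r.components : ℚ) *
        ∑ a ∈ (Finset.univ : Finset (ZMod r.n)ˣ).filter (fun a =>
          (∑ ℓ ∈ r.n.primeFactors.attach, Multiplicative.toAdd
            (ψ ℓ.1 (ZMod.unitsMap (Nat.dvd_of_mem_primeFactors ℓ.2) a))).val = j),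
          ratPlusSymbol f ((((a : ZMod r.n).val : ℕ) : ℚ) / (r.n : ℚ)) : ℚ) : ℝ) - mid| ≤ rad) :
    BSDp W r.p :=
  haveI : NeZero r.n := ⟨(Fact.out : r.n.Prime).ne_zero⟩
  X6.bsdp_rankOne_of_certifiedL W hKim hϖ hGZK hmod hrs hr hνp hν hp hX hr1 hq hv f hf hℓ hcyc ψ hψ
    (r.bins_eq_of_validHasse_of_ball (hcs.validHasse_of_mem hc) hcp hcn hcden hcbins hD' hf hX.1.1 hcop ψ
      hball)

end Summit.BirchSwinnertonDyer.Rank1Residual.Supersingular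

end
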